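import Mathlib.Combinatorics.SimpleGraph.Connectivity.EdgeConnectivity
import Mathlib.Combinatorics.SimpleGraph.Walk.Maps
import Literature.Combinatorics.SimpleGraph.BrinkmannTuckerVanCleemput2021.Walks
import Literature.Combinatorics.SimpleGraph.BrinkmannTuckerVanCleemput2021.ConnectivityData
import HarnessLib

/-!
# `G70` is connected, 3-connected and 3-edge-connected

Snarks — the graphs of the Brinkmann–Tucker–Van Cleemput question
[BrinkmannTuckerVancleemput2021, §3.1] answered in `…Verdict` — are in particular 3-connected and
3-edge-connected cubic graphs.  This module certifies these properties of `G70` (`…G70`) in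
Mathlib's terms: `connected : G70.Connected`, `isEdgeConnected_three : G70.IsEdgeConnected 3`
(any two vertices stay joined after deleting fewer than three edges) and
`connected_induce_compl_pair : ∀ u v, (G70.induce {w | w ≠ u ∧ w ≠ v}).Connected` (deleting any
two vertices leaves a connected graph on the remaining `68`), via the walk form
`exists_walk_avoiding`.

Method (Menger-style certificates, data in `…ConnectivityData`, device in `…Walks`): for the
hub `0` and every vertex `a ≠ 0` the kernel checks three walks `0 → a` that are pairwise
internally vertex-disjoint and edge-disjoint (`hub0_ok`); two deleted edges, or two deleted
vertices other than `0` and `a`, miss one of them.  The same for the hub `1` (`hub1_ok`) covers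
deleted pairs containing `0`, and a walk system of `G70 - {0, 1}` (`tree01_ok`) the pair `{0, 1}`.
All evaluation is `decide +kernel` (standard axioms).

Provenance: refutations bundle `papers/_cross/refutations` (H21 seat pub-refute-2, 2026-08-18);
written for the tree under the Lean-in-tree rule (human 2026-08-18).
-/

namespace Literature.Combinatorics.SimpleGraph.BrinkmannTuckerVanCleemput2021

open _root_.SimpleGraph

/-- Row check for a hub `h` and target `a`: the first three listed walks go from `h` to `a`, are
pairwise internally vertex-disjoint and pairwise edge-disjoint. [folklore] -/
def hubOK (h a : Fin 70) (ws : List (List ℕ)) : Bool :=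
  walkB h a (W (ws.getD 0 [])) && walkB h a (W (ws.getD 1 [])) && walkB h a (W (ws.getD 2 [])) &&
  sdisj h a (W (ws.getD 0 [])) (W (ws.getD 1 [])) && sdisj h a (W (ws.getD 0 [])) (W (ws.getD 2 []))
  && sdisj h a (W (ws.getD 1 [])) (W (ws.getD 2 [])) &&
  edisj (W (ws.getD 0 [])) (W (ws.getD 1 [])) && edisj (W (ws.getD 0 [])) (W (ws.getD 2 [])) &&
  edisj (W (ws.getD 1 [])) (W (ws.getD 2 []))

/-- Kernel fact: the hub-`0` walk system passes for every target `a ≠ 0`. [folklore] -/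
theorem hub0_ok : ∀ a : Fin 70, a ≠ 0 → hubOK 0 a (hub0Table.getD a []) = true := by
  decide +kernel

/-- Kernel fact: the hub-`1` walk system passes for every target `a ≠ 1`. [folklore] -/
theorem hub1_ok : ∀ a : Fin 70, a ≠ 1 → hubOK 1 a (hub1Table.getD a []) = true := by
  decide +kernel

/-- Row check for `G70 - {0, 1}`: a walk `2 → a` through vertices other than `0`, `1`.
[folklore] -/
def treeOK (a : Fin 70) (l : List ℕ) : Bool :=
  walkB 2 a (W l) && (W l).all fun x => decide (x ≠ 0) && decide (x ≠ 1)

/-- Kernel fact: the walk system of `G70 - {0, 1}` passes for every `a ∉ {0, 1}`. [folklore] -/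
theorem tree01_ok : ∀ a : Fin 70, a ≠ 0 → a ≠ 1 → treeOK a (tree01Table.getD a []) = true := by
  decide +kernel

/-- Unpacking a passing hub row: three walks with the nine checked properties. [folklore] -/
theorem hub_walks {h a : Fin 70} {ws : List (List ℕ)} (hk : hubOK h a ws = true) :
    ∃ l₁ l₂ l₃ : List (Fin 70), walkB h a l₁ = true ∧ walkB h a l₂ = true ∧ walkB h a l₃ = true ∧
      sdisj h a l₁ l₂ = true ∧ sdisj h a l₁ l₃ = true ∧ sdisj h a l₂ l₃ = true ∧
      edisj l₁ l₂ = true ∧ edisj l₁ l₃ = true ∧ edisj l₂ l₃ = true := by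
  simp only [hubOK, Bool.and_eq_true] at hk
  obtain ⟨⟨⟨⟨⟨⟨⟨⟨h₁, h₂⟩, h₃⟩, s₁₂⟩, s₁₃⟩, s₂₃⟩, e₁₂⟩, e₁₃⟩, e₂₃⟩ := hk
  exact ⟨_, _, _, h₁, h₂, h₃, s₁₂, s₁₃, s₂₃, e₁₂, e₁₃, e₂₃⟩

/-- Every vertex is reachable from `0`. [folklore] -/
theorem reachable_zero (a : Fin 70) : G70.Reachable 0 a := by
  by_cases ha : a = 0
  · subst ha
    rfl
  · obtain ⟨l₁, -, -, h₁, -⟩ := hub_walks (hub0_ok a ha)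
    obtain ⟨p, -, -⟩ := exists_walk h₁
    exact ⟨p⟩

/-- **`G70` is connected.** [folklore] -/
theorem connected : G70.Connected :=
  G70.connected_iff_exists_forall_reachable.2 ⟨0, reachable_zero⟩

/-- After deleting a set of fewer than three edges, every vertex is still reachable from `0`:
of the three edge-disjoint walks `0 → a`, one is untouched. [folklore] -/
theorem reachable_deleteEdges_zero {s : Set (Sym2 (Fin 70))} (hs : s.encard < 3) (a : Fin 70) :
    (G70.deleteEdges s).Reachable 0 a := by
  by_cases ha : a = 0
  · subst ha
    rfl
  obtain ⟨l₁, l₂, l₃, h₁, h₂, h₃, -, -, -, e₁₂, e₁₃, e₂₃⟩ := hub_walks (hub0_ok a ha)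
  obtain ⟨p₁, -, hp₁⟩ := exists_walk h₁
  obtain ⟨p₂, -, hp₂⟩ := exists_walk h₂
  obtain ⟨p₃, -, hp₃⟩ := exists_walk h₃
  by_contra hcon
  have meets : ∀ {p : G70.Walk 0 a} {l : List (Fin 70)},
      p.edges = (dartsL l).map (fun d => s(d.1, d.2)) → ∃ d ∈ dartsL l, s(d.1, d.2) ∈ s := by
    intro p l hp
    by_contra hh
    push Not at hh
    refine hcon ⟨p.toDeleteEdges s fun e he => ?_⟩
    rw [hp, List.mem_map] at he
    obtain ⟨d, hd, rfl⟩ := he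
    exact hh d hd
  obtain ⟨d₁, m₁, i₁⟩ := meets hp₁
  obtain ⟨d₂, m₂, i₂⟩ := meets hp₂
  obtain ⟨d₃, m₃, i₃⟩ := meets hp₃
  have n₁₂ := edisj_edge e₁₂ m₁ m₂
  have n₁₃ := edisj_edge e₁₃ m₁ m₃
  have n₂₃ := edisj_edge e₂₃ m₂ m₃
  have h3 : (3 : ℕ∞) ≤ s.encard := by
    have hc : ({s(d₁.1, d₁.2), s(d₂.1, d₂.2), s(d₃.1, d₃.2)} : Set (Sym2 (Fin 70))).encard = 3 :=
      Set.encard_eq_three.2 ⟨_, _, _, n₁₂, n₁₃, n₂₃, rfl⟩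
    rw [← hc]
    apply Set.encard_le_encard
    intro e he
    rcases he with rfl | rfl | rfl <;> assumption
  exact (not_lt.2 h3) (by exact_mod_cast hs)

/-- **`G70` is 3-edge-connected**: any two vertices remain reachable after deleting fewer than
three edges. [folklore] -/
theorem isEdgeConnected_three : G70.IsEdgeConnected 3 := fun u v _ hs =>
  (reachable_deleteEdges_zero hs u).symm.trans (reachable_deleteEdges_zero hs v)

/-- From a passing hub row: for any two vertices `u, v` other than `h` and `a` there is a walk
`h → a` avoiding both (each of `u`, `v` lies inside at most one of three internally disjoint
walks). [folklore] -/
theorem exists_walk_avoiding_of_hubOK {h a u v : Fin 70} {ws : List (List ℕ)}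
    (hk : hubOK h a ws = true) (hu : u ≠ h) (hu' : u ≠ a) (hv : v ≠ h) (hv' : v ≠ a) :
    ∃ p : G70.Walk h a, u ∉ p.support ∧ v ∉ p.support := by
  obtain ⟨l₁, l₂, l₃, h₁, h₂, h₃, s₁₂, s₁₃, s₂₃, -, -, -⟩ := hub_walks hk
  obtain ⟨p₁, hp₁, -⟩ := exists_walk h₁
  obtain ⟨p₂, hp₂, -⟩ := exists_walk h₂
  obtain ⟨p₃, hp₃, -⟩ := exists_walk h₃
  rw [← hp₁] at s₁₂ s₁₃
  rw [← hp₂] at s₁₂ s₂₃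
  rw [← hp₃] at s₁₃ s₂₃
  by_cases a₁ : u ∈ p₁.support
  · have a₂ := sdisj_sound s₁₂ a₁ hu hu'
    have a₃ := sdisj_sound s₁₃ a₁ hu hu'
    by_cases b₂ : v ∈ p₂.support
    · exact ⟨p₃, a₃, sdisj_sound s₂₃ b₂ hv hv'⟩
    · exact ⟨p₂, a₂, b₂⟩
  · by_cases b₁ : v ∈ p₁.support
    · have b₂ := sdisj_sound s₁₂ b₁ hv hv'
      have b₃ := sdisj_sound s₁₃ b₁ hv hv'
      by_cases a₂ : u ∈ p₂.support
      · exact ⟨p₃, sdisj_sound s₂₃ a₂ hu hu', b₃⟩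
      · exact ⟨p₂, a₂, b₂⟩
    · exact ⟨p₁, a₁, b₁⟩

/-- Walks from the hub `0` avoiding two given vertices `u, v ≠ 0`. [folklore] -/
theorem exists_walk_avoiding_zero {a u v : Fin 70} (hu : u ≠ 0) (hv : v ≠ 0) (hu' : u ≠ a)
    (hv' : v ≠ a) : ∃ p : G70.Walk 0 a, u ∉ p.support ∧ v ∉ p.support := by
  by_cases ha : a = 0
  · subst ha
    exact ⟨Walk.nil, by simpa using hu, by simpa using hv⟩
  · exact exists_walk_avoiding_of_hubOK (hub0_ok a ha) hu hu' hv hv'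

/-- Walks from the hub `1` avoiding two given vertices `u, v ≠ 1`. [folklore] -/
theorem exists_walk_avoiding_one {a u v : Fin 70} (hu : u ≠ 1) (hv : v ≠ 1) (hu' : u ≠ a)
    (hv' : v ≠ a) : ∃ p : G70.Walk 1 a, u ∉ p.support ∧ v ∉ p.support := by
  by_cases ha : a = 1
  · subst ha
    exact ⟨Walk.nil, by simpa using hu, by simpa using hv⟩
  · exact exists_walk_avoiding_of_hubOK (hub1_ok a ha) hu hu' hv hv'

/-- Walks from `2` avoiding the vertices `0` and `1`. [folklore] -/
theorem exists_walk_avoiding_zero_one {a : Fin 70} (h0 : a ≠ 0) (h1 : a ≠ 1) :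
    ∃ p : G70.Walk 2 a, (0 : Fin 70) ∉ p.support ∧ (1 : Fin 70) ∉ p.support := by
  have hk := tree01_ok a h0 h1
  simp only [treeOK, Bool.and_eq_true, List.all_eq_true, decide_eq_true_eq] at hk
  obtain ⟨hw, hall⟩ := hk
  obtain ⟨p, hp, -⟩ := exists_walk hw
  refine ⟨p, fun hm => ?_, fun hm => ?_⟩
  · exact (hall 0 (hp ▸ hm)).1 rfl
  · exact (hall 1 (hp ▸ hm)).2 rfl

/-- **`G70` is 3-connected (walk form)**: any two vertices `a, b` outside a pair `{u, v}` are
joined by a walk avoiding `u` and `v`. [folklore] -/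
theorem exists_walk_avoiding (u v a b : Fin 70) (hau : a ≠ u) (hav : a ≠ v) (hbu : b ≠ u)
    (hbv : b ≠ v) : ∃ p : G70.Walk a b, u ∉ p.support ∧ v ∉ p.support := by
  suffices H : ∃ r : Fin 70, (∃ p : G70.Walk r a, u ∉ p.support ∧ v ∉ p.support) ∧
      (∃ q : G70.Walk r b, u ∉ q.support ∧ v ∉ q.support) by
    obtain ⟨r, ⟨p, hp⟩, ⟨q, hq⟩⟩ := H
    refine ⟨p.reverse.append q, ?_, ?_⟩
    · rw [Walk.mem_support_append_iff, Walk.support_reverse, List.mem_reverse]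
      exact fun h => h.elim hp.1 hq.1
    · rw [Walk.mem_support_append_iff, Walk.support_reverse, List.mem_reverse]
      exact fun h => h.elim hp.2 hq.2
  by_cases h0 : u ≠ 0 ∧ v ≠ 0
  · exact ⟨0, exists_walk_avoiding_zero h0.1 h0.2 hau.symm hav.symm,
      exists_walk_avoiding_zero h0.1 h0.2 hbu.symm hbv.symm⟩
  by_cases h1 : u ≠ 1 ∧ v ≠ 1
  · exact ⟨1, exists_walk_avoiding_one h1.1 h1.2 hau.symm hav.symm,
      exists_walk_avoiding_one h1.1 h1.2 hbu.symm hbv.symm⟩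
  -- now `{u, v} = {0, 1}`
  have huv : (u = 0 ∧ v = 1) ∨ (u = 1 ∧ v = 0) := by
    rw [not_and_or, not_ne_iff, not_ne_iff] at h0 h1
    rcases h0 with rfl | rfl <;> rcases h1 with h | h <;> simp_all
  have key : ∀ {c : Fin 70}, c ≠ u → c ≠ v →
      ∃ p : G70.Walk 2 c, u ∉ p.support ∧ v ∉ p.support := by
    intro c hcu hcv
    rcases huv with ⟨rfl, rfl⟩ | ⟨rfl, rfl⟩
    · exact exists_walk_avoiding_zero_one hcu hcv
    · obtain ⟨p, hp0, hp1⟩ := exists_walk_avoiding_zero_one hcv hcu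
      exact ⟨p, hp1, hp0⟩
  exact ⟨2, key hau hav, key hbu hbv⟩

/-- **`G70` is 3-connected**: deleting any two vertices `u, v` leaves a connected graph (the
subgraph induced on the other vertices; for `u = v` one vertex is deleted). [folklore] -/
theorem connected_induce_compl_pair (u v : Fin 70) :
    (G70.induce {w : Fin 70 | w ≠ u ∧ w ≠ v}).Connected := by
  have hr : ∃ r : Fin 70, r ≠ u ∧ r ≠ v := by
    by_cases h0 : (0 : Fin 70) ≠ u ∧ (0 : Fin 70) ≠ v
    · exact ⟨0, h0⟩
    by_cases h1 : (1 : Fin 70) ≠ u ∧ (1 : Fin 70) ≠ v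
    · exact ⟨1, h1⟩
    refine ⟨2, ?_, ?_⟩
    · rintro rfl
      simp only [ne_eq, not_and_or, not_not] at h0 h1
      rcases h0 with h | rfl
      · exact absurd h (by decide)
      · rcases h1 with h | h
        · exact absurd h (by decide)
        · exact absurd h (by decide)
    · rintro rfl
      simp only [ne_eq, not_and_or, not_not] at h0 h1
      rcases h0 with rfl | h
      · rcases h1 with h | h
        · exact absurd h (by decide)
        · exact absurd h (by decide)
      · exact absurd h (by decide)
  obtain ⟨r, hru, hrv⟩ := hr
  haveI : Nonempty (↥({w : Fin 70 | w ≠ u ∧ w ≠ v} : Set (Fin 70))) := ⟨⟨r, hru, hrv⟩⟩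
  refine Connected.mk fun x y => ?_
  obtain ⟨p, hpu, hpv⟩ := exists_walk_avoiding u v x.1 y.1 x.2.1 x.2.2 y.2.1 y.2.2
  have hs : ∀ w ∈ p.support, w ∈ {w : Fin 70 | w ≠ u ∧ w ≠ v} := fun w hw =>
    ⟨fun h => hpu (h ▸ hw), fun h => hpv (h ▸ hw)⟩
  exact ⟨p.induce _ hs⟩

end Literature.Combinatorics.SimpleGraph.BrinkmannTuckerVanCleemput2021
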